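import Literature.MathematicalPhysics.QuantumLattice.HubbardChainEnergyDensityAt
import HarnessLib

/-!
# Ventures/CertifiedManyBodySolver — Transport/LTIDualHubbardChain.lean

HONEST FRAMING: first certified bounds; not a superconductivity verdict; every number certified or labelled float.

LANE-B TRANSPORT, fermion (Hubbard-chain) companion of `Transport/LTIDualSpinChain.lean` (lead D-18 r72; LEAN-MAP §6 R7 = G8;
SOUNDNESS-ltisdp.md S1–S4/S7, Hubbard case). In the tree the local fermion algebra of a window `Λ' ⊂ ℤ` IS a matrix algebra on
the window's Fock space (`FermionOp Λ' = Matrix (Finset (Orb (PolySite Λ'))) _ ℂ`, Jordan–Wigner being the identity of that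
presentation), so the DUAL of the pure `lti(n)` relaxation of FORMAT-ltisdp — energy `E`, density multipliers `μ_σ` with target
`ν`, the multiplier `Y` of the local-translation-invariance row `Tr₁ ρ = Tr_n ρ`, and a positive semidefinite slack `W` on the
window Fock space with `Γ(h₀) − E·1 − Σ_σ μ_σ (n_{0σ} − ν·1) = W + (Γ(shift Y) − Γ(Y))` — is a WINDOW CERTIFICATE of
`HubbardWindowCertificateAffine.lean` with ONE Gram block (over Fock matrix units, `gramForm_fockSingle_eq`) and ONE translation
row, all other families empty. Hence, as theorems (thin corollaries of the tree's transports [cite: Han2020Bootstrap, §2]):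

* `lti_dual_chain_energyPerSite_ge` — every periodic ring `L ≥ 3` on which the 1-thickened window projects injectively, every
  particle number `2·nh ≤ 2L`: `E + (Σ_σ μ_σ)(nh/L − ν) ≤ E₀(ring L, 2nh)/L` (SOUNDNESS-ltisdp S2–S4: no uniqueness, no closed
  shell — the transport symmetry-averages an arbitrary sector ground state);
* `lti_dual_chainEnergyDensity_ge` — half filling (`ν = 1/2`, `U ≥ 0`): `E ≤ hubbardChainEnergyDensity t U` (S7);
* `lti_dual_chainEnergyDensityAt_ge` — filling `p/q` (`ν = p/(2q)`): `E ≤ hubbardChainEnergyDensityAt t U p q` (the doped M1 object).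

NOT covered (as for the spin file): (i) the by-value link from the ltisdp readers' generic conic statement (certsdp-problem/0,
BOARD D-10) — the certificate must EXPORT the operator triple `(E [, μ], Y, W)` with `W` in the window Fock basis (the FORMAT-ltisdp
§4.1 Jordan–Wigner product basis `s = 2n↑ + n↓` per site is a relabelling of `Finset (Orb (PolySite Λ'))`, the exporter's or a later
file's job); (ii) the coarse-grained `mps(n,D,A)` relaxation [cite: KullEtAl2024, §2.5] — theorem B of R7.
-/

noncomputable section

namespace Summit.Ventures.CertifiedManyBodySolver.Transport

open Matrix Finset
open Literature.Probability.LatticeModels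
open Literature.MathematicalPhysics.QuantumLattice
open Literature.MathematicalPhysics.QuantumLattice.HubbardWave0
open Literature.MathematicalPhysics.QuantumLattice.ThermodynamicLimit
open Literature.MathematicalPhysics.QuantumManyBody.StateRelaxation
open scoped ComplexOrder BigOperators

/-- A window operator on Fock space is the Gram form of its own entries over Fock matrix units (`O s := single s₀ s 1`):
`gramForm W O = W`. Local twin of `Transport.gramForm_single_eq` (LTIDualSpinChain.lean), kept private here so that this
file does not wait on that module. [folklore] -/
private theorem gramForm_fockSingle_eq {ι : Type*} [Fintype ι] [DecidableEq ι] (W : Matrix ι ι ℂ) (i₀ : ι) :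
    gramForm W (fun i => Matrix.single i₀ i (1 : ℂ)) = W := by
  unfold gramForm
  conv_rhs => rw [Matrix.matrix_eq_sum_single W]
  refine Finset.sum_congr rfl fun i _ => Finset.sum_congr rfl fun j _ => ?_
  rw [Matrix.star_eq_conjTranspose, Matrix.conjTranspose_single, star_one, Matrix.single_mul_single_same,
    one_mul, Matrix.smul_single, smul_eq_mul, mul_one]

section Ring

variable {L : ℕ} [NeZero L]

/-- **LTI dual ⇒ energy per site of every long Hubbard ring (SOUNDNESS-ltisdp S2–S4, fermion case; lead D-18 r72).**
Data: a window `Λ' ⊂ ℤ` containing `{-1, 0, 1}` (so the energy density `h₀` embeds, `h0`), an inner region `Λ ⊆ Λ'` with its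
lattice neighbours in `Λ'` and its unit translate `Λ + 1 ⊆ Λ'`; density multipliers `μ_σ` with target `ν`; a slack
`W ⪰ 0` in `FermionOp Λ'` and a multiplier `Y ∈ FermionOp Λ`; the LTI DUAL IDENTITY
`Γ(h₀) − E·1 − Σ_σ μ_σ (n_{0σ} − ν·1) = W + (Γ(Λ+1 ↪ Λ')(shift Y) − Γ(Λ ↪ Λ') Y)`.
Then for every ring `L ≥ 3` with `x ↦ x mod L` injective on `thicken Λ' 1` and every `nh ≤ L`:
`E + (Σ_σ μ_σ)(nh/L − ν) ≤ energyPerSite (hubbardChain L) t U (2·nh)`. [cite: Han2020Bootstrap, §2] -/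
theorem lti_dual_chain_energyPerSite_ge (t U : ℝ) (hL : 3 ≤ L) {nh : ℕ} (hn : nh ≤ L)
    {Λ Λ' : Finset (Site 1)} (hΛ : Λ ⊆ Λ')
    (hclosed : ∀ x ∈ Λ, ∀ i : Fin 1, x + unitVec i ∈ Λ' ∧ x - unitVec i ∈ Λ')
    (h0 : thicken ({0} : Finset (Site 1)) 1 ⊆ Λ') (hz : (0 : Site 1) ∈ Λ')
    (hInj : Set.InjOn (Torus.proj (d := 1) L) ↑(thicken Λ' 1))
    (μ : Fin 2 → ℝ) (ν : ℝ)
    (hsh : affShiftSet 1 (unitVec 0) Λ ⊆ Λ')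
    (W : FermionOp Λ') (hW : W.PosSemidef) (Y : FermionOp Λ) {E : ℝ}
    (hcert : fermionEmbed (PolySite.incl h0) ((hubbardFermionInteraction 1 t U).meanEnergyObs 1) -
        (E : ℂ) • (1 : FermionOp Λ') -
        ∑ σ : Fin 2, ((μ σ : ℝ) : ℂ) • (nAt 0 hz σ - ((ν : ℝ) : ℂ) • (1 : FermionOp Λ')) =
      W + (fermionEmbed (PolySite.incl hsh) (fermionEmbed (PolySite.affEmb 1 (unitVec 0) Λ) Y) -
        fermionEmbed (PolySite.incl hΛ) Y)) :
    E + (∑ σ : Fin 2, μ σ) * ((nh : ℝ) / (L : ℝ) - ν) ≤ energyPerSite (hubbardChain L) t U (2 * nh) := by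
  classical
  have key := hubbardChain_energyPerSite_ge_of_window_certificate t U hL hn hΛ hclosed h0 hz hInj μ ν
    (Λm := W) hW (fun s => Matrix.single (∅ : Finset (Orb (PolySite Λ'))) s (1 : ℂ))
    (∅ : Finset (Fin 0)) (fun _ => 0)
    ({()} : Finset Unit) (fun _ => 1) (fun _ => unitVec 0) (fun _ => hsh) (fun _ => Y)
    (∅ : Finset (Fin 0)) (fun _ => 0) (fun _ => []) (fun j hj => absurd hj (Finset.notMem_empty j))
    (∅ : Finset (Fin 0)) (fun _ => 0) (fun _ => 0)
    (∅ : Finset (Fin 0)) (fun _ => 0) (fun _ => [])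
    (c := E) (by
      rw [gramForm_fockSingle_eq, hcert]
      simp only [Finset.sum_empty, Finset.sum_singleton, zero_add, add_zero])
  simpa using key

end Ring

/-- **LTI dual ⇒ the half-filled chain's thermodynamic-limit energy density (SOUNDNESS-ltisdp S7, fermion case).**
With the data of `lti_dual_chain_energyPerSite_ge` at target density `ν = 1/2` and `U ≥ 0`:
`E ≤ hubbardChainEnergyDensity t U` — the by-name transport for a lane-B pure-`lti(n)` M1 row exported as `(E, μ, Y, W)`.
[cite: Han2020Bootstrap, §2] [cite: KullEtAl2024, §6.2] -/
theorem lti_dual_chainEnergyDensity_ge (t : ℝ) {U : ℝ} (hU : 0 ≤ U)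
    {Λ Λ' : Finset (Site 1)} (hΛ : Λ ⊆ Λ')
    (hclosed : ∀ x ∈ Λ, ∀ i : Fin 1, x + unitVec i ∈ Λ' ∧ x - unitVec i ∈ Λ')
    (h0 : thicken ({0} : Finset (Site 1)) 1 ⊆ Λ') (hz : (0 : Site 1) ∈ Λ')
    (μ : Fin 2 → ℝ)
    (hsh : affShiftSet 1 (unitVec 0) Λ ⊆ Λ')
    (W : FermionOp Λ') (hW : W.PosSemidef) (Y : FermionOp Λ) {E : ℝ}
    (hcert : fermionEmbed (PolySite.incl h0) ((hubbardFermionInteraction 1 t U).meanEnergyObs 1) -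
        (E : ℂ) • (1 : FermionOp Λ') -
        ∑ σ : Fin 2, ((μ σ : ℝ) : ℂ) • (nAt 0 hz σ - ((1 / 2 : ℝ) : ℂ) • (1 : FermionOp Λ')) =
      W + (fermionEmbed (PolySite.incl hsh) (fermionEmbed (PolySite.affEmb 1 (unitVec 0) Λ) Y) -
        fermionEmbed (PolySite.incl hΛ) Y)) :
    E ≤ hubbardChainEnergyDensity t U := by
  classical
  have key := hubbardChainEnergyDensity_ge_of_window_certificate t hU hΛ hclosed h0 hz μ
    (Λm := W) hW (fun s => Matrix.single (∅ : Finset (Orb (PolySite Λ'))) s (1 : ℂ))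
    (∅ : Finset (Fin 0)) (fun _ => 0)
    ({()} : Finset Unit) (fun _ => 1) (fun _ => unitVec 0) (fun _ => hsh) (fun _ => Y)
    (∅ : Finset (Fin 0)) (fun _ => 0) (fun _ => []) (fun j hj => absurd hj (Finset.notMem_empty j))
    (∅ : Finset (Fin 0)) (fun _ => 0) (fun _ => 0)
    (∅ : Finset (Fin 0)) (fun _ => 0) (fun _ => [])
    (c := E) (by
      rw [gramForm_fockSingle_eq, hcert]
      simp only [Finset.sum_empty, Finset.sum_singleton, zero_add, add_zero])
  simpa using key

/-- **LTI dual ⇒ the chain's thermodynamic-limit energy density at filling `p/q` (doped M1 object).** With the data of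
`lti_dual_chain_energyPerSite_ge` at target spin density `ν = p/(2q)` (`1 ≤ q`, `p ≤ 2q`, `U ≥ 0`):
`E ≤ hubbardChainEnergyDensityAt t U p q`. [cite: Han2020Bootstrap, §2] [cite: Ruelle1969, §2.2] -/
theorem lti_dual_chainEnergyDensityAt_ge (t : ℝ) {U : ℝ} (hU : 0 ≤ U) {p q : ℕ} (hq : 1 ≤ q) (hp : p ≤ 2 * q)
    {Λ Λ' : Finset (Site 1)} (hΛ : Λ ⊆ Λ')
    (hclosed : ∀ x ∈ Λ, ∀ i : Fin 1, x + unitVec i ∈ Λ' ∧ x - unitVec i ∈ Λ')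
    (h0 : thicken ({0} : Finset (Site 1)) 1 ⊆ Λ') (hz : (0 : Site 1) ∈ Λ')
    (μ : Fin 2 → ℝ)
    (hsh : affShiftSet 1 (unitVec 0) Λ ⊆ Λ')
    (W : FermionOp Λ') (hW : W.PosSemidef) (Y : FermionOp Λ) {E : ℝ}
    (hcert : fermionEmbed (PolySite.incl h0) ((hubbardFermionInteraction 1 t U).meanEnergyObs 1) -
        (E : ℂ) • (1 : FermionOp Λ') -
        ∑ σ : Fin 2, ((μ σ : ℝ) : ℂ) •
          (nAt 0 hz σ - (((p : ℝ) / (2 * (q : ℝ)) : ℝ) : ℂ) • (1 : FermionOp Λ')) =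
      W + (fermionEmbed (PolySite.incl hsh) (fermionEmbed (PolySite.affEmb 1 (unitVec 0) Λ) Y) -
        fermionEmbed (PolySite.incl hΛ) Y)) :
    E ≤ hubbardChainEnergyDensityAt t U p q := by
  classical
  have key := hubbardChainEnergyDensityAt_ge_of_window_certificate t hU hq hp hΛ hclosed h0 hz μ
    (Λm := W) hW (fun s => Matrix.single (∅ : Finset (Orb (PolySite Λ'))) s (1 : ℂ))
    (∅ : Finset (Fin 0)) (fun _ => 0)
    ({()} : Finset Unit) (fun _ => 1) (fun _ => unitVec 0) (fun _ => hsh) (fun _ => Y)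
    (∅ : Finset (Fin 0)) (fun _ => 0) (fun _ => []) (fun j hj => absurd hj (Finset.notMem_empty j))
    (∅ : Finset (Fin 0)) (fun _ => 0) (fun _ => 0)
    (∅ : Finset (Fin 0)) (fun _ => 0) (fun _ => [])
    (c := E) (by
      rw [gramForm_fockSingle_eq, hcert]
      simp only [Finset.sum_empty, Finset.sum_singleton, zero_add, add_zero])
  simpa using key

end Summit.Ventures.CertifiedManyBodySolver.Transport
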